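import Literature.MathematicalPhysics.QuantumFieldTheory.Balaban1983to89.B12Ineq349Flat

/-!
# `Balaban1983to89.B12Ineq417Flat` — [Balaban1987RG1] (4.16)–(4.17) p. 285 AT THE FLAT BACKGROUND: translation covariance of
the concrete composite averaging `Q_j(1, ·)` of [Balaban1985Averaging] on `ℤ^d`, the formula (4.16) for `∂_νB_μ`, and the
first-derivative bound (4.17) `|(∂_νB_μ)(x)| < O(1)(…)(L^jη)²` with «(3.32) and Proposition 5 [7]» supplied BY NAME — PROVED

HONEST FRAMING (cell `lit-balaban`, verbatim): statement-level skeleton of published theorems with citation tags; proofs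
where landed; nothing here is a claim about the Yang–Mills mass gap.

CITATION HEADER.  T. Bałaban, *Renormalization group approach to lattice gauge field theories. I. Generation of effective
actions in a small field approximation and a coupling constant renormalization in four dimensions*, Commun. Math. Phys.
**109** (1987) 249–301 [Balaban1987RG1] (cell paper B12; journal page = PDF page + 248; held
`paper:balaban1987-cmp109-rg-i-small-field`), p. 285 [PDF 37], read on the render
`b2b-balaban-ref1/pages/1987-cmp109-rg-I-small-field/…-p037-x2.png`; T. Bałaban, *Averaging operations for lattice gauge
theories*, Commun. Math. Phys. **98** (1985) 17–51 [Balaban1985Averaging] (cell paper B7), Prop. 4 p. 38, Prop. 5 (156) p. 42,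
(150) p. 40.  Unit `lit-balaban-r20` gen 4 (fold owner of B12; SKELETON row `B12.Eq4.16-4.18`, owner cell r09; this file is a
SUPPLEMENT to p07's `B12Eq416DerivB` — (4.16) PROVED there on a torus carrier for an ABSTRACT translation-invariant `C¹` map
`Q`, (4.17) typed there as the arithmetic `norm_dB_le` over NAMED inputs — and restates none of its declarations).

THE PRINT (verbatim, p. 285): «The operation Q_{j,μ} is translation invariant, i.e., Q_{j,μ}(ηA, x+a) = Q_{j,μ}(ηt_aA, x),
where (t_aA_ν)(x) = A_ν(x+a), a ∈ T₁^{(j)}, hence we have the following formula for the derivative ∂_νB_μ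
  (∂_νB_μ)(x) = ζ̃_□(x+e_ν)Q_{j,μ}(ηA, x+e_ν) − ζ̃_□(x)Q_{j,μ}(ηA, x)
    = Σ_{b⊂[x,x+e_ν]} ξ(∂^ξζ̃_□)(b)Q_{j,μ}(ηA, x+e_ν) + ζ̃_□(x)∫₀¹dt ⟨(δ/δA)Q_{j,μ}(ηA + ηt(t_{e_ν}A − A)), η(t_{e_ν}A − A)⟩,
  where x ∈ T₁^{(j)}, and for x′ ∈ T_ξ, (t_{e_ν}A − A)_λ(x′) = Σ_{b⊂[x′,x′+e_ν]} ξ(∂^ξA_λ)(b). (4.16)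
The field A is regular on η-lattice, it satisfies the bounds (3.32), hence the derivative ∂^ξA_λ can be bounded by O(1)L^jη.
The same remark applies to the derivative ∂^ξζ̃_□. More precisely, (3.32) and Proposition 5 [7] on functional derivatives of
averaging operations imply |(∂_νB_μ)(x)| < O(1)(α₂ + B₃O(1)Mα₀)(L^jη)² < α₁(L^jη)². (4.17) … For second order derivatives
we have a weaker conclusion … |(∂_λ∂_νB_μ)(x)| < α₁(L^jη)^{2+β}, 0 ≦ β ≦ β₀ < 1, (4.18) by similar considerations as in the
proof of (4.17). The inequalities (4.17), (4.18) hold for the field δB also.»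

DICTIONARY (b07's conventions of `B7Prop4Flat`/`B7Prop5Flat`/`B7Prop5FlatOperator`, all at the flat background `U₀ = 1`).
The fine lattice `T_ξ` is `ℤ^d` with UNIT steps (`B7Prop1Explicit.Site d`, `e ν`); the unit lattice `T₁^{(j)}` is `L^jℤ^d`,
its bond `⟨x, x+e_μ⟩`, `x = L^jz`, is indexed by `(z, μ) : Site d × Fin d`; `B`-variables `B = ηA : Site d → Fin d → 𝔸`;
`Q_{j,μ}(ηA, x) = Q_j(1, B)(z, μ) = B7Prop4Flat.logIter L B j z μ` (the composite (127) of [7]); the translation `t_a`,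
`a ∈ T₁^{(j)}`, is `shiftCfg (L^j • a)` on the fine lattice (`(t_aA)(x′) = A(x′ + a)`); the coarse step `e_ν` of `T₁^{(j)}`
is `L^j` fine steps.  SIZES: `b ≥ sup_{x,κ} ‖B(x,κ)‖` (print: `η·|A| < 2η(α₂ + B₃O(1)Mα₀)` by (3.32), `B12Ineq332.ineq332_sup`);
`g ≥ sup ‖B(x′+e_ν, λ) − B(x′, λ)‖` = the fine-step differences `ξ|∂^ξ(ηA)_λ|` (print: one `ξ`-step of `T_ξ` is one `η`-step
of the `k`-th scale, so `g = η·η|∇^ηA| < 2η²(α₂ + B₃O(1)Mα₀)` by (3.32), `B12Ineq332.ineq332_grad`; equivalently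
`|∂^ξA_λ| ≤ ξ⁻¹η·2(…) = O(1)L^jη`, the printed remark); `δ ≥ |ζ̃_□(x+e_ν) − ζ̃_□(x)| = |Σ_{b⊂[x,x+e_ν]} ξ(∂^ξζ̃_□)(b)|`
(print: «The same remark applies to the derivative ∂^ξζ̃_□», i.e. `δ = L^j·ξ·O(1)L^jη = O(1)L^jη`).  With these the right
side of `ineq417_flat` reads `O(1)L^jη·2L^j·2η(…) + 2dL^j(1 + C₃L^jb)·L^j·2η²(…) = O(1)(α₂ + B₃O(1)Mα₀)(L^jη)²`, which is
(4.17); `ineq417_flat_scaled` displays exactly this `(L^jη)²` law for `B = ηA`.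

WHAT THIS FILE PROVES (kernel, 0 sorry, standard axioms; object definitions `shiftCfg`, `locB`, `dlocB`, no `def … : Prop`):
* §1 `shiftCfg` and the translation covariance of every object of [7] Sect. B–D at `U₀ = 1` on `ℤ^d`: `hol_shiftCfg`,
  `Wcx_shiftCfg`, `Xavg_shiftCfg`, `bavg_shiftCfg`, `Favg_shiftCfg`, `vframe_shiftCfg`, `dbavg_shiftCfg`, `expCfg_shiftCfg`,
  and **`logIter_shiftCfg`**: `Q_j(1, B)(z + a, κ) = Q_j(1, t_{L^ja}B)(z, κ)` — the printed «Q_{j,μ}(ηA, x+a) = Q_{j,μ}(ηt_aA, x)»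
  for the concrete averaging.
* §2 the last display of (4.16) on `ℤ^d` (`shiftCfg_sub_eq_sum`: `(t_{e_ν}B − B)(x′) = Σ_{m<n}[B(x′+(m+1)e_ν) − B(x′+me_ν)]`)
  and the size `norm_shiftCfg_sub_le`: `‖(t_{ne_ν}B − B)(x′)‖ ≤ n·g`.
* §3 the localized field `locB ζ L B j z μ = ζ̃(z)·Q_j(1,B)(z,μ)`, its unit-lattice derivative `dlocB` and **(4.16)**:
  `eq416_flat_split` (product rule + translation covariance) and `eq416_flat` (the printed integral form, the second term as
  `∫₀¹dt ⟨D Q_j(1,·)(B + t(t_{e_ν}B − B)), t_{e_ν}B − B⟩` on the finite product `𝔸^S`, `S` = the bonds of `B^j(c₋) ∪ B^j(c₊)`,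
  by the locality `B7Prop5Flat.logIter_congr` and the `C¹`-regularity `B12Ineq349Flat.contDiffOn_avgMap_polydisc`).
* §4 **(4.17) AT THE FLAT BACKGROUND, HYPOTHESIS-FREE** for the concrete `Q_j(1, ·)`: `ineq417_flat`:
  `‖(∂_νB_μ)(z)‖ ≤ δ·2L^jb + |ζ̃(z)|·2dL^j(1 + C₃L^jb)·L^jg` under `L ≥ 2`, `sup ‖B‖ ≤ b`, `C₃(d,L)·L^j·b ≤ 1` (b07's
  smallness), inputs BY NAME `B7Prop4Flat.prop4_flat_induction` (`|Q_j(1,B)| ≤ 2L^jb`, (131) of [7]) and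
  `B7Prop5FlatOperator.opNorm_fderiv_real_avgMap_le` (Prop. 5 (156) of [7] in operator form, `‖D Q_j(1,·)‖ ≤ 2dL^j(1 + C₃L^jb)`)
  through the mean value inequality on the polydisc; `ineq417_flat_scaled`: the same for `B = ηA` with `sup|A| ≤ a`, fine
  differences of `A` `≤ ηa′`, `δ ≤ c_ζ·L^jη`, giving `‖(∂_νB_μ)(z)‖ ≤ (2c_ζa + 2d(1 + C₃L^jηa)a′)·(L^jη)²`.

DIVERGENCES / NOT PROVED.  Flat background only (`U₀ = 1`; the curved-background Prop. 5, `B7.Prop5Printed`, is neither used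
nor claimed — in [Balaban1987RG1] §4 the relevant `Q_j` acts at the background `U_j(□₀, 1)`, cf. (4.19), but the identification
of that background with b07's `U₀ = 1` objects is NOT made here); `ℤ^d`, no torus (p07's `B12Eq416DerivB` has the torus and an
abstract `Q`); the constants are explicit in b07's `B`-variables and the identification with the printed
`O(1)(α₂ + B₃O(1)Mα₀)(L^jη)²` is the DICTIONARY above, with (3.32) entering only through the sizes `b`, `g` (the tree's
`B12Ineq332.ineq332_sup/ineq332_grad` are the (3.32) members; they are not re-derived or imported here); (4.18) (second
differences, Hölder norms) and the sentence «hold for the field δB also» are NOT proved (no operator bound for the second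
derivative of `Q_j(1, ·)` is in the tree).
-/

noncomputable section

open scoped BigOperators
open Set MeasureTheory intervalIntegral
open Literature.MathematicalPhysics.QuantumFieldTheory.Balaban1983to89
open Literature.MathematicalPhysics.QuantumFieldTheory.Balaban1983to89.B7Prop1Explicit (Letter e hol stepHol treeWord
  seg boxVec Wcx Xavg bavg gammaWord expUnit)
open Literature.MathematicalPhysics.QuantumFieldTheory.Balaban1983to89.B7Prop1Local (loK bondHiK AgreeOn)
open Literature.MathematicalPhysics.QuantumFieldTheory.Balaban1983to89.B7Prop3Flat (Favg vframe dbavg expCfg insCfg C1)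
open Literature.MathematicalPhysics.QuantumFieldTheory.Balaban1983to89.B7Prop4Flat (logIter logIter_succ prop4_flat_induction
  isOpen_polydisc)
open Literature.MathematicalPhysics.QuantumFieldTheory.Balaban1983to89.B7Prop5Flat (C3 C3_pos bondsIn restr logIter_congr
  agreeOn_insCfg_restr)
open Literature.MathematicalPhysics.QuantumFieldTheory.Balaban1983to89.B7Prop5FlatOperator (avgMap avgMap_apply small8_of_C3
  differentiableAt_avgMap_real opNorm_fderiv_real_avgMap_le)
open Literature.MathematicalPhysics.QuantumFieldTheory.Balaban1983to89.B12Ineq349Flat (contDiffOn_avgMap_polydisc)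

namespace Literature.MathematicalPhysics.QuantumFieldTheory.Balaban1983to89.B12Ineq417Flat

variable {d : ℕ}

/-! ## §1 Translations `t_a` on `ℤ^d` and the translation covariance of the concrete averaging -/

section Shift

/-- **The translation `t_a`**: `(t_aF)(x) = F(x + a)` for any bond/site function on `ℤ^d` (print: «(t_aA_ν)(x) = A_ν(x+a)»).
[cite: Balaban1987RG1, (4.16) p.285] -/
def shiftCfg {β : Type*} (a : B7Prop1Explicit.Site d) (F : B7Prop1Explicit.Site d → β) : B7Prop1Explicit.Site d → β := fun x => F (x + a)

/-- Unfolding of `shiftCfg`. [cite: Balaban1987RG1, (4.16) p.285] (elementary API) -/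
@[simp] theorem shiftCfg_apply {β : Type*} (a : B7Prop1Explicit.Site d) (F : B7Prop1Explicit.Site d → β) (x : B7Prop1Explicit.Site d) : shiftCfg a F x = F (x + a) := rfl

/-- `t_0 = id`. [cite: Balaban1987RG1, (4.16) p.285] (elementary API; our proof) -/
@[simp] theorem shiftCfg_zero {β : Type*} (F : B7Prop1Explicit.Site d → β) : shiftCfg 0 F = F := by
  funext x; simp [shiftCfg]

/-- `t_a ∘ t_{a′} = t_{a+a′}`. [cite: Balaban1987RG1, (4.16) p.285] (elementary API; our proof) -/
theorem shiftCfg_shiftCfg {β : Type*} (a a' : B7Prop1Explicit.Site d) (F : B7Prop1Explicit.Site d → β) :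
    shiftCfg a (shiftCfg a' F) = shiftCfg (a + a') F := by
  funext x; simp [shiftCfg, add_assoc]

variable {G : Type*} [Group G]

/-- The bond variable traversed by a letter from `x` in the translated configuration is the one traversed from `x + a`.
[cite: Balaban1985Averaging, (9) p.18] (elementary API; our proof) -/
theorem stepHol_shiftCfg (a : B7Prop1Explicit.Site d) (V : B7Prop1Explicit.Site d → Fin d → G) (x : B7Prop1Explicit.Site d) (l : Letter d) :
    stepHol (shiftCfg a V) x l = stepHol V (x + a) l := by
  unfold stepHol
  simp only [shiftCfg_apply, add_right_comm x l.vec a]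

/-- **Parallel transports are translation covariant**: `(t_aV)(Γ based at x) = V(Γ based at x + a)`.
[cite: Balaban1985Averaging, (9) p.18] (elementary API; our proof) -/
theorem hol_shiftCfg (a : B7Prop1Explicit.Site d) (V : B7Prop1Explicit.Site d → Fin d → G) :
    ∀ (x : B7Prop1Explicit.Site d) (w : List (Letter d)), hol (shiftCfg a V) x w = hol V (x + a) w
  | x, [] => by simp
  | x, l :: w => by
    rw [B7Prop1Explicit.hol_cons, B7Prop1Explicit.hol_cons, stepHol_shiftCfg, hol_shiftCfg a V (x + l.vec) w,
      add_right_comm x l.vec a]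

end Shift

section ShiftAvg

variable {𝔸 : Type*} [NormedRing 𝔸] [NormedAlgebra ℂ 𝔸] [CompleteSpace 𝔸]

omit [NormedAlgebra ℂ 𝔸] [CompleteSpace 𝔸] in
/-- The loop variable `V(Γ_{c,x})V(c)⁻¹` of (42) is translation covariant. [cite: Balaban1985Averaging, (42) p.23]
(elementary API; our proof) -/
theorem Wcx_shiftCfg (L : ℕ) (a : B7Prop1Explicit.Site d) (V : B7Prop1Explicit.Site d → Fin d → 𝔸ˣ) (q : B7Prop1Explicit.Site d) (κ : Fin d) (r : B7Prop1Explicit.Site d) :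
    Wcx L (shiftCfg a V) q κ r = Wcx L V (q + a) κ r := by
  unfold Wcx
  rw [hol_shiftCfg, hol_shiftCfg]

omit [CompleteSpace 𝔸] in
/-- The exponent `X_c` of the block average (42) is translation covariant. [cite: Balaban1985Averaging, (42) p.23]
(elementary API; our proof) -/
theorem Xavg_shiftCfg (L : ℕ) (a : B7Prop1Explicit.Site d) (V : B7Prop1Explicit.Site d → Fin d → 𝔸ˣ) (q : B7Prop1Explicit.Site d) (κ : Fin d) :
    Xavg L (shiftCfg a V) q κ = Xavg L V (q + a) κ := by
  unfold Xavg
  simp_rw [Wcx_shiftCfg]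

/-- **The block average (42)/(43) is translation covariant**: `\overline{t_aV}(c) = V̄(c + a)`.
[cite: Balaban1985Averaging, (42)–(43) pp.23–24] (elementary API; our proof) -/
theorem bavg_shiftCfg (L : ℕ) (a : B7Prop1Explicit.Site d) (V : B7Prop1Explicit.Site d → Fin d → 𝔸ˣ) (q : B7Prop1Explicit.Site d) (κ : Fin d) :
    bavg L (shiftCfg a V) q κ = bavg L V (q + a) κ := by
  unfold bavg
  rw [Xavg_shiftCfg, hol_shiftCfg]

omit [CompleteSpace 𝔸] in
/-- The frame exponent `F(y)` of (110) is translation covariant. [cite: Balaban1985Averaging, (110) p.34]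
(elementary API; our proof) -/
theorem Favg_shiftCfg (L : ℕ) (a : B7Prop1Explicit.Site d) (V : B7Prop1Explicit.Site d → Fin d → 𝔸ˣ) (q : B7Prop1Explicit.Site d) :
    Favg L (shiftCfg a V) q = Favg L V (q + a) := by
  unfold Favg
  simp_rw [hol_shiftCfg]

/-- The block frame `v(y)` of (110)/(82) is translation covariant. [cite: Balaban1985Averaging, (110) p.34]
(elementary API; our proof) -/
theorem vframe_shiftCfg (L : ℕ) (a : B7Prop1Explicit.Site d) (V : B7Prop1Explicit.Site d → Fin d → 𝔸ˣ) (q : B7Prop1Explicit.Site d) :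
    vframe L (shiftCfg a V) q = vframe L V (q + a) := by
  unfold vframe
  rw [Favg_shiftCfg]

/-- **The double-bar average (89)/(90) at `V₀ = 1` is translation covariant.** [cite: Balaban1985Averaging, (89)–(90) p.31]
(elementary API; our proof) -/
theorem dbavg_shiftCfg (L : ℕ) (a : B7Prop1Explicit.Site d) (V : B7Prop1Explicit.Site d → Fin d → 𝔸ˣ) (q : B7Prop1Explicit.Site d) (κ : Fin d) :
    dbavg L (shiftCfg a V) q κ = dbavg L V (q + a) κ := by
  unfold dbavg
  rw [vframe_shiftCfg, vframe_shiftCfg, bavg_shiftCfg, add_right_comm q ((L : ℤ) • e κ) a]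

/-- `e^{t_aB} = t_a e^{B}` (bondwise exponential). [cite: Balaban1985Averaging, (121) p.36] (elementary API; our proof) -/
theorem expCfg_shiftCfg (a : B7Prop1Explicit.Site d) (B : B7Prop1Explicit.Site d → Fin d → 𝔸) : expCfg (shiftCfg a B) = shiftCfg a (expCfg B) := by
  funext x κ; rfl

/-- **TRANSLATION COVARIANCE OF THE CONCRETE COMPOSITE AVERAGING** — the printed «Q_{j,μ}(ηA, x+a) = Q_{j,μ}(ηt_aA, x),
where (t_aA_ν)(x) = A_ν(x+a), a ∈ T₁^{(j)}» for `Q_j(1, ·) = B7Prop4Flat.logIter L · j`: a translation by `a` of the `j`-th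
(unit) lattice is the translation by `L^ja` of the fine lattice, `Q_j(1, B)(z + a, κ) = Q_j(1, t_{L^ja}B)(z, κ)`.
[cite: Balaban1987RG1, (4.16) p.285; Balaban1985Averaging, (127) p.37] -/
theorem logIter_shiftCfg (L : ℕ) (B : B7Prop1Explicit.Site d → Fin d → 𝔸) :
    ∀ (j : ℕ) (a z : B7Prop1Explicit.Site d) (κ : Fin d),
      logIter L B j (z + a) κ = logIter L (shiftCfg (((L : ℤ) ^ j) • a) B) j z κ
  | 0, a, z, κ => by simp [shiftCfg]
  | j + 1, a, z, κ => by
    rw [logIter_succ, logIter_succ, smul_add]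
    have hE : shiftCfg ((L : ℤ) • a) (expCfg (logIter L B j)) =
        expCfg (logIter L (shiftCfg (((L : ℤ) ^ (j + 1)) • a) B) j) := by
      funext x μ
      simp only [shiftCfg_apply, expCfg]
      rw [logIter_shiftCfg L B j ((L : ℤ) • a) x μ, smul_smul, ← pow_succ]
    rw [← dbavg_shiftCfg L ((L : ℤ) • a) (expCfg (logIter L B j)) ((L : ℤ) • z) κ, hE]

/-- The coarse unit step `e_ν` of `T₁^{(j)}` read at level `0`: `Q_j(1, B)(z + e_ν, κ) = Q_j(1, t_{L^je_ν}B)(z, κ)`.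
[cite: Balaban1987RG1, (4.16) p.285] -/
theorem logIter_succ_site (L : ℕ) (B : B7Prop1Explicit.Site d → Fin d → 𝔸) (j : ℕ) (z : B7Prop1Explicit.Site d) (ν κ : Fin d) :
    logIter L B j (z + e ν) κ = logIter L (shiftCfg (((L : ℤ) ^ j) • e ν) B) j z κ :=
  logIter_shiftCfg L B j (e ν) z κ

end ShiftAvg

/-! ## §2 The last display of (4.16): `t_{e_ν}B − B` as a sum of fine-step differences, and its size -/

section Differences

variable {M : Type*} [AddCommGroup M]

/-- **(4.16), last display, on `ℤ^d`**: `(t_{ne_ν}F − F)(x′) = Σ_{m<n} [F(x′ + (m+1)e_ν) − F(x′ + me_ν)]` — the printed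
«(t_{e_ν}A − A)_λ(x′) = Σ_{b⊂[x′,x′+e_ν]} ξ(∂^ξA_λ)(b)» with `ξ(∂^ξA_λ)(b) = A_λ(b₊) − A_λ(b₋)` and the coarse step `= n` fine
steps. [cite: Balaban1987RG1, (4.16) p.285] -/
theorem shiftCfg_sub_eq_sum (n : ℕ) (ν : Fin d) (F : B7Prop1Explicit.Site d → M) (x : B7Prop1Explicit.Site d) :
    shiftCfg ((n : ℤ) • e ν) F x - F x
      = ∑ m ∈ Finset.range n, (F (x + ((m + 1 : ℕ) : ℤ) • e ν) - F (x + (m : ℤ) • e ν)) := by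
  rw [Finset.sum_range_sub (fun m => F (x + (m : ℤ) • e ν)) n]
  simp [shiftCfg]

variable {V : Type*} [SeminormedAddCommGroup V]

/-- **Size of `t_{ne_ν}F − F`**: if every fine-step difference in direction `ν` is `≤ g`, then `‖(t_{ne_ν}F − F)(x′)‖ ≤ n·g`
(print: «the derivative ∂^ξA_λ can be bounded by O(1)L^jη», summed over the `L^j` bonds of `[x′, x′+e_ν]`).
[cite: Balaban1987RG1, (4.16)–(4.17) p.285] -/
theorem norm_shiftCfg_sub_le (ν : Fin d) (F : B7Prop1Explicit.Site d → V) {g : ℝ} (hg : ∀ x, ‖F (x + e ν) - F x‖ ≤ g) :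
    ∀ (n : ℕ) (x : B7Prop1Explicit.Site d), ‖shiftCfg ((n : ℤ) • e ν) F x - F x‖ ≤ n * g
  | 0, x => by simp
  | n + 1, x => by
    have hsplit : shiftCfg (((n + 1 : ℕ) : ℤ) • e ν) F x - F x
        = (F (x + (n : ℤ) • e ν + e ν) - F (x + (n : ℤ) • e ν)) + (shiftCfg ((n : ℤ) • e ν) F x - F x) := by
      simp only [shiftCfg_apply, Nat.cast_succ, add_smul, one_smul, add_assoc]
      abel
    rw [hsplit]
    calc ‖(F (x + (n : ℤ) • e ν + e ν) - F (x + (n : ℤ) • e ν)) + (shiftCfg ((n : ℤ) • e ν) F x - F x)‖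
        ≤ ‖F (x + (n : ℤ) • e ν + e ν) - F (x + (n : ℤ) • e ν)‖ + ‖shiftCfg ((n : ℤ) • e ν) F x - F x‖ :=
          norm_add_le _ _
      _ ≤ g + n * g := add_le_add (hg _) (norm_shiftCfg_sub_le ν F hg n x)
      _ = (n + 1 : ℕ) * g := by push_cast; ring

end Differences

/-! ## §3 The localized field `B_μ(x) = ζ̃_□(x)Q_{j,μ}(ηA, x)` and (4.16) -/

section Eq416

variable {𝔸 : Type*} [NormedRing 𝔸] [NormedAlgebra ℂ 𝔸] [CompleteSpace 𝔸]

/-- **The localized field** `B_μ(x) = ζ̃_□(x)Q_{j,μ}(ηA, x)` on the unit lattice `T₁^{(j)}`, for the concrete `Q_j(1, ·)`: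
`locB ζ L B j z μ = ζ̃(z)·Q_j(1, B)(z, μ)` (`ζ̃ : T₁^{(j)} → ℝ` arbitrary; its profile is r09's `B12PartitionUnity270`).
[cite: Balaban1987RG1, (4.16) p.285 (p.284 l.−2)] -/
def locB (ζ : B7Prop1Explicit.Site d → ℝ) (L : ℕ) (B : B7Prop1Explicit.Site d → Fin d → 𝔸) (j : ℕ) (z : B7Prop1Explicit.Site d) (μ : Fin d) : 𝔸 :=
  (ζ z : ℝ) • logIter L B j z μ

/-- **The unit-lattice derivative** `(∂_νB_μ)(x) = B_μ(x + e_ν) − B_μ(x)`. [cite: Balaban1987RG1, (4.16) p.285] -/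
def dlocB (ζ : B7Prop1Explicit.Site d → ℝ) (L : ℕ) (B : B7Prop1Explicit.Site d → Fin d → 𝔸) (j : ℕ) (ν : Fin d) (z : B7Prop1Explicit.Site d) (μ : Fin d) : 𝔸 :=
  locB ζ L B j (z + e ν) μ - locB ζ L B j z μ

/-- **(4.16), first line, for the concrete averaging**: product rule and translation covariance,
`(∂_νB_μ)(x) = [ζ̃(x+e_ν) − ζ̃(x)]·Q_{j,μ}(B, x+e_ν) + ζ̃(x)·[Q_{j,μ}(t_{e_ν}B, x) − Q_{j,μ}(B, x)]`.
[cite: Balaban1987RG1, (4.16) p.285] -/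
theorem eq416_flat_split (ζ : B7Prop1Explicit.Site d → ℝ) (L : ℕ) (B : B7Prop1Explicit.Site d → Fin d → 𝔸) (j : ℕ) (ν : Fin d) (z : B7Prop1Explicit.Site d)
    (μ : Fin d) :
    dlocB ζ L B j ν z μ
      = (ζ (z + e ν) - ζ z) • logIter L B j (z + e ν) μ
        + ζ z • (logIter L (shiftCfg (((L : ℤ) ^ j) • e ν) B) j z μ - logIter L B j z μ) := by
  rw [← logIter_succ_site L B j z ν μ]
  simp only [dlocB, locB, sub_smul, smul_sub]
  abel

/-- The variables of `Q_j(1, ·)(c)`, `c = ⟨z, z+e_μ⟩` of the `j`-th lattice: the bonds of the box `B^j(c₋) ∪ B^j(c₊)`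
(locality (141)/Prop. 4 of [7]). [cite: Balaban1985Averaging, (141) p.39, p.24] -/
def boxBonds (L j : ℕ) (z : B7Prop1Explicit.Site d) (μ : Fin d) : Finset (B7Prop1Explicit.Site d × Fin d) := bondsIn (loK L j z) (bondHiK L j z μ)

/-- The one-element set `{c}` of coarse bonds. [cite: Balaban1985Averaging, (127) p.37] (elementary API) -/
def oneBond (z : B7Prop1Explicit.Site d) (μ : Fin d) : Finset (B7Prop1Explicit.Site d × Fin d) := {(z, μ)}

/-- The coarse bond `c` as an element of `{c}`. [cite: Balaban1985Averaging, (127) p.37] (elementary API) -/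
def theBond (z : B7Prop1Explicit.Site d) (μ : Fin d) : oneBond (d := d) z μ := ⟨(z, μ), Finset.mem_singleton_self _⟩

/-- **Locality, value level**: `Q_j(1, F)(c)` IS the `𝔸^S`-function `avgMap` of `B7Prop5FlatOperator` (`S` = the bonds of
the box of `c`) evaluated at the restriction of `F` (`B7Prop5Flat.logIter_congr` BY NAME).
[cite: Balaban1985Averaging, p.24 (sentence after (43)), Prop. 4 p.38] -/
theorem logIter_eq_avgMap_restr (L : ℕ) (hL : 1 ≤ L) (F : B7Prop1Explicit.Site d → Fin d → 𝔸) (j : ℕ) (z : B7Prop1Explicit.Site d) (μ : Fin d) :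
    logIter L F j z μ
      = avgMap L (boxBonds L j z μ) (oneBond z μ) j (restr (boxBonds L j z μ) F) (theBond z μ) := by
  rw [avgMap_apply]
  exact logIter_congr L hL j z μ (agreeOn_insCfg_restr (loK L j z) (bondHiK L j z μ) F)

omit [CompleteSpace 𝔸] in
/-- Restriction commutes with the affine combinations used below. [folklore] -/
private theorem restr_add_smul_sub (S : Finset (B7Prop1Explicit.Site d × Fin d)) (F F' : B7Prop1Explicit.Site d → Fin d → 𝔸) (t : ℝ) :
    restr S F + t • (restr S F' - restr S F) = restr S (F + t • (F' - F)) := by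
  funext s; simp [restr]

/-- The fundamental theorem of calculus along a segment of field space, `f(p + v) − f(p) = ∫₀¹dt ⟨Df(p + tv), v⟩`, for `f` of
class `C¹` on an open set containing the segment. [folklore] -/
private theorem ftc_segment {E F : Type*} [NormedAddCommGroup E] [NormedSpace ℝ E] [NormedAddCommGroup F]
    [NormedSpace ℝ F] [CompleteSpace F] {s : Set E} (hs : IsOpen s) {f : E → F} (hf : ContDiffOn ℝ 1 f s) (p v : E)
    (hseg : ∀ t ∈ Icc (0 : ℝ) 1, p + t • v ∈ s) :
    f (p + v) - f p = ∫ t in (0 : ℝ)..1, fderiv ℝ f (p + t • v) v := by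
  have hγ : ∀ t : ℝ, HasDerivAt (fun τ : ℝ => p + τ • v) v t := fun t => by
    simpa using ((hasDerivAt_id t).smul_const v).const_add p
  have hdiff : ∀ t ∈ Icc (0 : ℝ) 1, DifferentiableAt ℝ f (p + t • v) := fun t ht =>
    (hf.differentiableOn one_ne_zero).differentiableAt (hs.mem_nhds (hseg t ht))
  have hderiv : ∀ t ∈ uIcc (0 : ℝ) 1,
      HasDerivAt (fun τ : ℝ => f (p + τ • v)) (fderiv ℝ f (p + t • v) v) t := by
    intro t ht
    rw [Set.uIcc_of_le zero_le_one] at ht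
    exact (hdiff t ht).hasFDerivAt.comp_hasDerivAt t (hγ t)
  have hcont : ContinuousOn (fun t : ℝ => fderiv ℝ f (p + t • v) v) (Icc (0 : ℝ) 1) := by
    have hD : ContinuousOn (fderiv ℝ f) s := hf.continuousOn_fderiv_of_isOpen hs le_rfl
    have hray : ContinuousOn (fun t : ℝ => p + t • v) (Icc (0 : ℝ) 1) :=
      (continuous_const.add (continuous_id.smul continuous_const)).continuousOn
    have hcomp : ContinuousOn (fun t : ℝ => fderiv ℝ f (p + t • v)) (Icc (0 : ℝ) 1) :=
      hD.comp hray fun t ht => hseg t ht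
    exact (ContinuousLinearMap.apply ℝ F v).continuous.comp_continuousOn hcomp
  have hint : IntervalIntegrable (fun t : ℝ => fderiv ℝ f (p + t • v) v) volume 0 1 := by
    refine ContinuousOn.intervalIntegrable ?_
    rw [Set.uIcc_of_le zero_le_one]
    exact hcont
  have h := intervalIntegral.integral_eq_sub_of_hasDerivAt hderiv hint
  simp only [one_smul, zero_smul, add_zero] at h
  exact h.symm

omit [CompleteSpace 𝔸] in
/-- Convex combinations of two fields in the open polydisc of radius `b` stay in it (bondwise). [folklore] -/
private theorem norm_add_smul_sub_lt {F F' : B7Prop1Explicit.Site d → Fin d → 𝔸} {b : ℝ} (hF : ∀ x κ, ‖F x κ‖ < b)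
    (hF' : ∀ x κ, ‖F' x κ‖ < b) {t : ℝ} (ht : t ∈ Icc (0 : ℝ) 1) (x : B7Prop1Explicit.Site d) (κ : Fin d) :
    ‖(F + t • (F' - F)) x κ‖ < b := by
  have h1 : (F + t • (F' - F)) x κ = (1 - t) • F x κ + t • F' x κ := by
    simp only [Pi.add_apply, Pi.smul_apply, Pi.sub_apply, smul_sub, sub_smul, one_smul]
    abel
  rw [h1]
  rcases eq_or_lt_of_le ht.1 with h0 | h0
  · rw [← h0]; simpa using hF x κ
  calc ‖(1 - t) • F x κ + t • F' x κ‖ ≤ ‖(1 - t) • F x κ‖ + ‖t • F' x κ‖ := norm_add_le _ _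
    _ = (1 - t) * ‖F x κ‖ + t * ‖F' x κ‖ := by
        rw [norm_smul, norm_smul, Real.norm_of_nonneg (sub_nonneg.2 ht.2), Real.norm_of_nonneg ht.1]
    _ < (1 - t) * b + t * b := by
        have := mul_lt_mul_of_pos_left (hF' x κ) h0
        have h2 : (1 - t) * ‖F x κ‖ ≤ (1 - t) * b := mul_le_mul_of_nonneg_left (hF x κ).le (sub_nonneg.2 ht.2)
        linarith
    _ = b := by ring

/-- The FTC on the polydisc for `Q_j(1, ·)` on `𝔸^S → 𝔸^T`, read at one coarse bond `c`:
`Q(p + v)(c) − Q(p)(c) = ∫₀¹dt ⟨DQ(p + tv), v⟩(c)` when the segment lies in the open polydisc of radius `b`, `C₃L^jb ≤ 1`.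
[cite: Balaban1987RG1, (4.16) p.285; Balaban1985Averaging, Prop. 4 p.38] (elementary API; our proof) -/
theorem avgMap_sub_eq_integral (L : ℕ) (hL : 2 ≤ L) (S T : Finset (B7Prop1Explicit.Site d × Fin d)) (j : ℕ) {b : ℝ}
    (hb : 0 ≤ b) (hk : C3 d L * ((L : ℝ) ^ j * b) ≤ 1) (p v : S → 𝔸)
    (hseg : ∀ t ∈ Icc (0 : ℝ) 1, ∀ s, ‖(p + t • v) s‖ < b) (c : T) :
    avgMap L S T j (p + v) c - avgMap L S T j p c
      = ∫ t in (0 : ℝ)..1, fderiv ℝ (avgMap L S T j) (p + t • v) v c := by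
  have hopen : IsOpen {y : S → 𝔸 | ∀ s, ‖y s‖ < b} := isOpen_polydisc S b
  have hC1 : ContDiffOn ℝ 1 (avgMap L S T j) {y : S → 𝔸 | ∀ s, ‖y s‖ < b} :=
    contDiffOn_avgMap_polydisc L hL S T j hb hk
  have hseg' : ∀ t ∈ Icc (0 : ℝ) 1, p + t • v ∈ {y : S → 𝔸 | ∀ s, ‖y s‖ < b} := fun t ht s => hseg t ht s
  have hftc := ftc_segment hopen hC1 p v hseg'
  have hcomp : avgMap L S T j (p + v) c - avgMap L S T j p c
      = (∫ t in (0 : ℝ)..1, fderiv ℝ (avgMap L S T j) (p + t • v) v) c := by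
    rw [← Pi.sub_apply, hftc]
  -- evaluation at `c` commutes with the interval integral (a continuous linear map)
  have hint : IntervalIntegrable (fun t : ℝ => fderiv ℝ (avgMap L S T j) (p + t • v) v) volume 0 1 := by
    refine ContinuousOn.intervalIntegrable ?_
    rw [Set.uIcc_of_le zero_le_one]
    have hD : ContinuousOn (fderiv ℝ (avgMap L S T j)) {y : S → 𝔸 | ∀ s, ‖y s‖ < b} :=
      hC1.continuousOn_fderiv_of_isOpen hopen le_rfl
    have hray : ContinuousOn (fun t : ℝ => p + t • v) (Icc (0 : ℝ) 1) :=
      (continuous_const.add (continuous_id.smul continuous_const)).continuousOn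
    exact (ContinuousLinearMap.apply ℝ (T → 𝔸) v).continuous.comp_continuousOn (hD.comp hray fun t ht => hseg' t ht)
  have hcomm := (ContinuousLinearMap.proj (R := ℝ) (φ := fun _ : T => 𝔸) c).intervalIntegral_comp_comm hint
  simp only [ContinuousLinearMap.proj_apply] at hcomm
  rw [hcomp, ← hcomm]

/-- **(4.16) for the concrete averaging, printed (integral) form**: with `S` = the bonds of the box of `c = ⟨x, x+e_μ⟩`,
`Q = Q_j(1, ·)` on `𝔸^S` (`avgMap`), `B|S` the restriction and `v = (t_{e_ν}B − B)|S`,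
`(∂_νB_μ)(x) = [ζ̃(x+e_ν) − ζ̃(x)]·Q_{j,μ}(B, x+e_ν) + ζ̃(x)·∫₀¹dt ⟨(δ/δB)Q_{j,μ}(B + t(t_{e_ν}B − B)), t_{e_ν}B − B⟩(c)`,
valid on the open polydisc `sup ‖B‖ < b` with `C₃(d, L)·L^j·b ≤ 1` (where `Q_j(1, ·)` is `C¹`,
`B12Ineq349Flat.contDiffOn_avgMap_polydisc`). [cite: Balaban1987RG1, (4.16) p.285; Balaban1985Averaging, Prop. 4 p.38] -/
theorem eq416_flat (ζ : B7Prop1Explicit.Site d → ℝ) (L : ℕ) (hL : 2 ≤ L) (B : B7Prop1Explicit.Site d → Fin d → 𝔸) (j : ℕ)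
    (ν : Fin d) (z : B7Prop1Explicit.Site d) (μ : Fin d) {b : ℝ} (hb : 0 ≤ b) (hk : C3 d L * ((L : ℝ) ^ j * b) ≤ 1)
    (hB : ∀ x κ, ‖B x κ‖ < b) :
    dlocB ζ L B j ν z μ
      = (ζ (z + e ν) - ζ z) • logIter L B j (z + e ν) μ
        + ζ z • ∫ t in (0 : ℝ)..1,
            fderiv ℝ (avgMap L (boxBonds L j z μ) (oneBond z μ) j)
              (restr (boxBonds L j z μ) B
                + t • (restr (boxBonds L j z μ) (shiftCfg (((L : ℤ) ^ j) • e ν) B) - restr (boxBonds L j z μ) B))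
              (restr (boxBonds L j z μ) (shiftCfg (((L : ℤ) ^ j) • e ν) B) - restr (boxBonds L j z μ) B)
              (theBond z μ) := by
  have hL1 : 1 ≤ L := le_trans (by norm_num) hL
  rw [eq416_flat_split, logIter_eq_avgMap_restr L hL1 B j z μ,
    logIter_eq_avgMap_restr L hL1 (shiftCfg (((L : ℤ) ^ j) • e ν) B) j z μ]
  have hpv : restr (boxBonds L j z μ) (shiftCfg (((L : ℤ) ^ j) • e ν) B)
      = restr (boxBonds L j z μ) B
        + (restr (boxBonds L j z μ) (shiftCfg (((L : ℤ) ^ j) • e ν) B) - restr (boxBonds L j z μ) B) := by abel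
  have hseg : ∀ t ∈ Icc (0 : ℝ) 1, ∀ s : boxBonds L j z μ,
      ‖(restr (boxBonds L j z μ) B
        + t • (restr (boxBonds L j z μ) (shiftCfg (((L : ℤ) ^ j) • e ν) B) - restr (boxBonds L j z μ) B)) s‖ < b := by
    intro t ht s
    rw [restr_add_smul_sub]
    exact norm_add_smul_sub_lt hB (fun x κ => by simpa [shiftCfg] using hB (x + ((L : ℤ) ^ j) • e ν) κ) ht s.1.1 s.1.2
  rw [hpv, avgMap_sub_eq_integral L hL (boxBonds L j z μ) (oneBond z μ) j hb hk _ _ hseg (theBond z μ), ← hpv]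

end Eq416

/-! ## §4 (4.17) at the flat background, hypothesis-free for the concrete averaging -/

section Ineq417

variable {𝔸 : Type*} [NormedRing 𝔸] [NormedAlgebra ℂ 𝔸] [CompleteSpace 𝔸]

/-- The size of `Q_j(1, B)`: `‖Q_j(1, B)(c)‖ ≤ 2L^jb` on `sup ‖B‖ ≤ b`, `C₃L^jb ≤ 1` ((131) of [7],
`B7Prop4Flat.prop4_flat_induction` BY NAME; `C₃`-smallness implies the `8C₁` one, `B7Prop5FlatOperator.small8_of_C3`).
[cite: Balaban1985Averaging, (131) p.38, Prop. 4 p.38] -/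
theorem norm_logIter_le (L : ℕ) (hL : 2 ≤ L) (B : B7Prop1Explicit.Site d → Fin d → 𝔸) (j : ℕ) {b : ℝ} (hb : 0 ≤ b)
    (hk : C3 d L * ((L : ℝ) ^ j * b) ≤ 1) (hB : ∀ x κ, ‖B x κ‖ ≤ b) (z : B7Prop1Explicit.Site d) (κ : Fin d) :
    ‖logIter L B j z κ‖ ≤ 2 * ((L : ℝ) ^ j * b) := by
  have hL1 : 1 ≤ L := le_trans (by norm_num) hL
  have h8 : 8 * C1 d * ((L : ℝ) ^ j * b) ≤ 1 := small8_of_C3 d L hL1 (by positivity) hk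
  exact (prop4_flat_induction L hL B hb hB j h8 j le_rfl).2.2 z κ

/-- **The translation step, bounded by Prop. 5 of [7] in operator form**: on `sup ‖B‖ ≤ b`, `C₃L^jb ≤ 1`,
`‖Q_{j,μ}(t_{e_ν}B, x) − Q_{j,μ}(B, x)‖ ≤ 2dL^j(1 + C₃L^jb)·sup_{x′} ‖(t_{e_ν}B − B)(x′)‖` — the mean value inequality on the
(convex) polydisc with `‖D Q_j(1, ·)‖ ≤ 2dL^j(1 + C₃L^jb)` (`B7Prop5FlatOperator.opNorm_fderiv_real_avgMap_le` BY NAME).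
[cite: Balaban1987RG1, (4.17) p.285; Balaban1985Averaging, Prop. 5 (156) p.42] -/
theorem norm_logIter_shift_sub_le (L : ℕ) (hL : 2 ≤ L) (B : B7Prop1Explicit.Site d → Fin d → 𝔸) (j : ℕ) {b : ℝ} (hb : 0 ≤ b)
    (hk : C3 d L * ((L : ℝ) ^ j * b) ≤ 1) (hB : ∀ x κ, ‖B x κ‖ ≤ b) (a : B7Prop1Explicit.Site d) {m : ℝ}
    (hm : ∀ x κ, ‖shiftCfg a B x κ - B x κ‖ ≤ m) (z : B7Prop1Explicit.Site d) (μ : Fin d) :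
    ‖logIter L (shiftCfg a B) j z μ - logIter L B j z μ‖
      ≤ 2 * d * (L : ℝ) ^ j * (1 + C3 d L * ((L : ℝ) ^ j * b)) * m := by
  have hL1 : 1 ≤ L := le_trans (by norm_num) hL
  set S := boxBonds L j z μ with hS
  set T := oneBond (d := d) z μ with hT
  set K : Set (S → 𝔸) := {y | ∀ s, ‖y s‖ ≤ b} with hK
  have hm0 : 0 ≤ m := le_trans (norm_nonneg _) (hm 0 μ)
  -- the polydisc is convex and both restricted fields lie in it
  have hKconv : Convex ℝ K := by
    intro y hy y' hy' s t hs ht hst r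
    calc ‖(s • y + t • y') r‖ = ‖s • y r + t • y' r‖ := rfl
      _ ≤ ‖s • y r‖ + ‖t • y' r‖ := norm_add_le _ _
      _ = s * ‖y r‖ + t * ‖y' r‖ := by rw [norm_smul, norm_smul, Real.norm_of_nonneg hs, Real.norm_of_nonneg ht]
      _ ≤ s * b + t * b := add_le_add (mul_le_mul_of_nonneg_left (hy r) hs) (mul_le_mul_of_nonneg_left (hy' r) ht)
      _ = b := by rw [← add_mul, hst, one_mul]
  have hp : restr S B ∈ K := fun s => hB _ _
  have hp' : restr S (shiftCfg a B) ∈ K := fun s => by simpa [restr, shiftCfg] using hB (s.1.1 + a) s.1.2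
  have hdiff : ∀ y ∈ K, DifferentiableAt ℝ (avgMap L S T j) y := fun y hy =>
    differentiableAt_avgMap_real L hL S T j hb hk hy
  have hbound : ∀ y ∈ K, ‖fderiv ℝ (avgMap L S T j) y‖ ≤ 2 * d * (L : ℝ) ^ j * (1 + C3 d L * ((L : ℝ) ^ j * b)) :=
    fun y hy => opNorm_fderiv_real_avgMap_le L hL S T j hb hk hy
  have hmvt := hKconv.norm_image_sub_le_of_norm_fderiv_le hdiff hbound hp hp'
  -- the distance of the two restrictions
  have hdist : ‖restr S (shiftCfg a B) - restr S B‖ ≤ m := by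
    refine (pi_norm_le_iff_of_nonneg hm0).2 fun s => ?_
    simpa [restr] using hm s.1.1 s.1.2
  have hC0 : 0 ≤ 2 * d * (L : ℝ) ^ j * (1 + C3 d L * ((L : ℝ) ^ j * b)) := by
    have := C3_pos d L hL1
    positivity
  rw [logIter_eq_avgMap_restr L hL1 (shiftCfg a B) j z μ, logIter_eq_avgMap_restr L hL1 B j z μ]
  calc ‖avgMap L S T j (restr S (shiftCfg a B)) (theBond z μ) - avgMap L S T j (restr S B) (theBond z μ)‖
      = ‖(avgMap L S T j (restr S (shiftCfg a B)) - avgMap L S T j (restr S B)) (theBond z μ)‖ := rfl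
    _ ≤ ‖avgMap L S T j (restr S (shiftCfg a B)) - avgMap L S T j (restr S B)‖ := norm_le_pi_norm _ _
    _ ≤ 2 * d * (L : ℝ) ^ j * (1 + C3 d L * ((L : ℝ) ^ j * b)) * ‖restr S (shiftCfg a B) - restr S B‖ := hmvt
    _ ≤ 2 * d * (L : ℝ) ^ j * (1 + C3 d L * ((L : ℝ) ^ j * b)) * m := mul_le_mul_of_nonneg_left hdist hC0

/-- **(4.17) AT THE FLAT BACKGROUND, HYPOTHESIS-FREE for the concrete `Q_j(1, ·)`** («(3.32) and Proposition 5 [7] on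
functional derivatives of averaging operations imply |(∂_νB_μ)(x)| < O(1)(α₂ + B₃O(1)Mα₀)(L^jη)²»): for `L ≥ 2`,
`sup ‖B‖ ≤ b`, `C₃(d, L)·L^j·b ≤ 1`, fine-step `ν`-differences of `B` bounded by `g`, `|ζ̃(x+e_ν) − ζ̃(x)| ≤ δ`,
`‖(∂_νB_μ)(x)‖ ≤ δ·2L^jb + |ζ̃(x)|·2dL^j(1 + C₃L^jb)·L^jg`.  With the DICTIONARY of the header (`b = 2η(…)`, `g = 2η²(…)`,
`δ = O(1)L^jη`, `|ζ̃| ≤ 1`) the right side is the printed `O(1)(α₂ + B₃O(1)Mα₀)(L^jη)²`.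
[cite: Balaban1987RG1, (4.17) p.285; Balaban1985Averaging, Prop. 5 (156) p.42, (131) p.38] -/
theorem ineq417_flat (ζ : B7Prop1Explicit.Site d → ℝ) (L : ℕ) (hL : 2 ≤ L) (B : B7Prop1Explicit.Site d → Fin d → 𝔸) (j : ℕ) (ν : Fin d)
    (z : B7Prop1Explicit.Site d) (μ : Fin d) {b g δ : ℝ} (hb : 0 ≤ b) (hk : C3 d L * ((L : ℝ) ^ j * b) ≤ 1)
    (hB : ∀ x κ, ‖B x κ‖ ≤ b) (hg : ∀ x κ, ‖B (x + e ν) κ - B x κ‖ ≤ g) (hζ : |ζ (z + e ν) - ζ z| ≤ δ) :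
    ‖dlocB ζ L B j ν z μ‖
      ≤ δ * (2 * ((L : ℝ) ^ j * b))
        + |ζ z| * (2 * d * (L : ℝ) ^ j * (1 + C3 d L * ((L : ℝ) ^ j * b)) * ((L : ℝ) ^ j * g)) := by
  have hg0 : 0 ≤ g := le_trans (norm_nonneg _) (hg 0 μ)
  -- size of the translation step `t_{e_ν}B − B` over the `L^j` fine bonds
  have hm : ∀ x κ, ‖shiftCfg (((L : ℤ) ^ j) • e ν) B x κ - B x κ‖ ≤ (L : ℝ) ^ j * g := by
    intro x κ
    have h := norm_shiftCfg_sub_le ν (fun y => B y κ) (fun y => hg y κ) (L ^ j) x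
    have hcast : (((L ^ j : ℕ) : ℤ)) • e ν = ((L : ℤ) ^ j) • e ν := by push_cast; rfl
    rw [hcast] at h
    simpa [shiftCfg] using h
  rw [eq416_flat_split]
  refine le_trans (norm_add_le _ _) (add_le_add ?_ ?_)
  · rw [norm_smul, Real.norm_eq_abs]
    exact mul_le_mul hζ (norm_logIter_le L hL B j hb hk hB _ μ) (norm_nonneg _)
      (le_trans (abs_nonneg _) hζ)
  · rw [norm_smul, Real.norm_eq_abs]
    exact mul_le_mul_of_nonneg_left
      (norm_logIter_shift_sub_le L hL B j hb hk hB (((L : ℤ) ^ j) • e ν) hm z μ) (abs_nonneg _)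

/-- **(4.17), the printed `(L^jη)²` law** for `B = ηA`: if `sup ‖A‖ ≤ a`, the fine-step `ν`-differences of `A` are `≤ ηa′`
(one fine step of `T_ξ` is one `η`-step: `η|∇^ηA| ≤ ηa′`), `|ζ̃| ≤ 1`, `|ζ̃(x+e_ν) − ζ̃(x)| ≤ c_ζ·L^jη`, `0 < η`, and
`C₃(d, L)·L^j·ηa ≤ 1`, then `‖(∂_νB_μ)(x)‖ ≤ (2c_ζa + 2d(1 + C₃L^jηa)a′)·(L^jη)²` — the printed
`O(1)(α₂ + B₃O(1)Mα₀)(L^jη)²` with (3.32) giving `a, a′ < 2(α₂ + B₃O(1)Mα₀)`. [cite: Balaban1987RG1, (4.17) p.285] -/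
theorem ineq417_flat_scaled (ζ : B7Prop1Explicit.Site d → ℝ) (L : ℕ) (hL : 2 ≤ L) (A : B7Prop1Explicit.Site d → Fin d → 𝔸) (j : ℕ) (ν : Fin d)
    (z : B7Prop1Explicit.Site d) (μ : Fin d) {η a a' cζ : ℝ} (hη : 0 < η) (ha : 0 ≤ a)
    (hk : C3 d L * ((L : ℝ) ^ j * (η * a)) ≤ 1) (hA : ∀ x κ, ‖A x κ‖ ≤ a)
    (hA' : ∀ x κ, ‖A (x + e ν) κ - A x κ‖ ≤ η * a') (hζ1 : |ζ z| ≤ 1)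
    (hζ : |ζ (z + e ν) - ζ z| ≤ cζ * ((L : ℝ) ^ j * η)) :
    ‖dlocB ζ L ((η : ℂ) • A) j ν z μ‖
      ≤ (2 * cζ * a + 2 * d * (1 + C3 d L * ((L : ℝ) ^ j * (η * a))) * a') * ((L : ℝ) ^ j * η) ^ 2 := by
  have hηn : ‖(η : ℂ)‖ = η := by rw [Complex.norm_real, Real.norm_of_nonneg hη.le]
  have hB : ∀ x κ, ‖((η : ℂ) • A) x κ‖ ≤ η * a := fun x κ => by
    rw [Pi.smul_apply, Pi.smul_apply, norm_smul, hηn]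
    exact mul_le_mul_of_nonneg_left (hA x κ) hη.le
  have hg : ∀ x κ, ‖((η : ℂ) • A) (x + e ν) κ - ((η : ℂ) • A) x κ‖ ≤ η * (η * a') := fun x κ => by
    rw [Pi.smul_apply, Pi.smul_apply, Pi.smul_apply, Pi.smul_apply, ← smul_sub, norm_smul, hηn]
    exact mul_le_mul_of_nonneg_left (hA' x κ) hη.le
  have ha'0 : 0 ≤ a' := by
    have h := le_trans (norm_nonneg _) (hA' 0 μ)
    nlinarith
  have hL1 : 1 ≤ L := le_trans (by norm_num) hL
  have hcζ : 0 ≤ cζ * ((L : ℝ) ^ j * η) := le_trans (abs_nonneg _) hζ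
  have hC3 : 0 < C3 d L := C3_pos d L hL1
  have h := ineq417_flat ζ L hL ((η : ℂ) • A) j ν z μ (by positivity) hk hB hg hζ
  have hsecond : |ζ z| * (2 * d * (L : ℝ) ^ j * (1 + C3 d L * ((L : ℝ) ^ j * (η * a))) * ((L : ℝ) ^ j * (η * (η * a'))))
      ≤ 1 * (2 * d * (L : ℝ) ^ j * (1 + C3 d L * ((L : ℝ) ^ j * (η * a))) * ((L : ℝ) ^ j * (η * (η * a')))) :=
    mul_le_mul_of_nonneg_right hζ1 (by positivity)
  calc ‖dlocB ζ L ((η : ℂ) • A) j ν z μ‖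
      ≤ cζ * ((L : ℝ) ^ j * η) * (2 * ((L : ℝ) ^ j * (η * a)))
        + 1 * (2 * d * (L : ℝ) ^ j * (1 + C3 d L * ((L : ℝ) ^ j * (η * a))) * ((L : ℝ) ^ j * (η * (η * a')))) := by
          exact le_trans h (add_le_add le_rfl hsecond)
    _ = (2 * cζ * a + 2 * d * (1 + C3 d L * ((L : ℝ) ^ j * (η * a))) * a') * ((L : ℝ) ^ j * η) ^ 2 := by ring

end Ineq417

end Literature.MathematicalPhysics.QuantumFieldTheory.Balaban1983to89.B12Ineq417Flat

end
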